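import Literature.NumberTheory.LFunctions.ChainTableWalk1
import Literature.NumberTheory.LFunctions.ChainTableWalk2
import Literature.NumberTheory.LFunctions.ChainTableWalk3
import Literature.NumberTheory.LFunctions.ChainTableWalk4
import Literature.NumberTheory.LFunctions.ChainTableWalk5
import Literature.NumberTheory.LFunctions.ChainTableWalk6
import Literature.NumberTheory.LFunctions.ChainTableWalk7
import Literature.NumberTheory.LFunctions.ChainTableWalk8
import Literature.NumberTheory.LFunctions.ChainCheckSound
import HarnessLib

/-!
# Completeness of the prime table: `ChainCheck.TableOK ChainTable.table 4599989`
# (plan N1 of provefact `Literature.NumberTheory.LFunctions.robin_iff`)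

Topic: `Literature/NumberTheory/LFunctions`. Pure proof file (nothing asserted, no definition). The
eight kernel facts `ChainTable.walk1` … `ChainTable.walk8` (`ChainTableWalk1.lean` …
`ChainTableWalk8.lean`: the gap walk `ChainTable.walkH` of `ChainTableSieve.lean` succeeds on the
eight consecutive pieces of `40305` entries of `table.tail`, each started at the last entry of the
previous one) are glued into ONE walk over the whole tail,
`walk_tail : walkH 323201 1 table.tail = some 4599989`, by two syntactic lemmas on `walkH`
(monotonicity in the fuel, `walkH_mono`, and concatenation, `walkH_append`: a successful walk from
`a` over `s₁` ending at `M` followed by a successful walk from `M` over `s₂` ending at `L` is a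
successful walk from `a` over `s₁ ++ s₂` ending at `L`) and the decomposition of a list into its
pieces `(l.drop (40305 i)).take 40305` (`pieces_eq`, with `ChainTable.tail_drop_nil` for the end).
One application of `ChainTable.walkH_sound` then gives: `table.tail` is strictly increasing, its
entries are the odd numbers in `(1, 4599989]` that survived, and every odd prime `≤ 4599989` is an
entry; with the head `table.head? = some 2` (`head_table`, kernel, lazy) this is exactly
`ChainCheck.TableOK table 4599989` (`tableOK`): sorted, entries in `[2, 4599989]`, head `2`,
complete. (That the table starts `2, 3, 5, 7, 11, 13, …`, the shape consumed by
`ChainCheck.initD_inv`, holds by `rfl` — lazy evaluation of the first decoded entries — and is not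
restated.) Consumer: `RobinCABelow.lean` (the certified run of the colossally abundant chain,
`robinCA_below (4^11)`).

## References

* (method) Eratosthenes; compositeness by gcd with a primorial, folklore.
* G. Robin, *Grandes valeurs de la fonction somme des diviseurs et hypothèse de Riemann*, J. Math.
  Pures Appl. 63 (1984), 187–213, §3. [Robin1984]
-/

namespace Literature.NumberTheory.LFunctions.ChainTable

/-! ### Two syntactic lemmas on `walkH` -/

/-- `bif c then x else none` is `some L` iff `c` holds and `x = some L`. [folklore] -/
theorem bif_eq_some {c : Bool} {x : Option ℕ} {L : ℕ} :
    (bif c then x else none) = some L ↔ c = true ∧ x = some L := by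
  cases c <;> simp

/-- **Monotonicity of `walkH` in the fuel**: a successful walk stays successful (with the same last
entry) when given more fuel. [folklore] -/
theorem walkH_mono : ∀ (f f' a : ℕ) (seg : List ℕ) (L : ℕ),
    walkH f a seg = some L → f ≤ f' → walkH f' a seg = some L
  | 0, _, _, _, _, h, _ => by simp [walkH] at h
  | _ + 1, 0, _, _, _, _, hf => absurd hf (by omega)
  | _ + 1, _ + 1, a, [], L, h, _ => by simpa [walkH] using h
  | f + 1, f' + 1, a, b :: rest, L, h, hf => by
      simp only [walkH] at h ⊢
      obtain ⟨hc, h'⟩ := bif_eq_some.1 h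
      exact bif_eq_some.2 ⟨hc, walkH_mono f f' b rest L h' (by omega)⟩

/-- **Concatenation of walks**: if the walk from `a` over `s₁` succeeds and ends at `M`, and the walk
from `M` over `s₂` succeeds and ends at `L`, then the walk from `a` over `s₁ ++ s₂` (with the total
fuel) succeeds and ends at `L`. [folklore] -/
theorem walkH_append : ∀ (f₁ : ℕ) {f₂ a M L : ℕ} (s₁ : List ℕ) {s₂ : List ℕ},
    walkH f₁ a s₁ = some M → walkH f₂ M s₂ = some L → walkH (f₁ + f₂) a (s₁ ++ s₂) = some L
  | 0, _, _, _, _, _, _, h, _ => by simp [walkH] at h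
  | f₁ + 1, f₂, a, M, L, [], s₂, h₁, h₂ => by
      simp only [walkH, Option.some.injEq] at h₁
      subst h₁
      rw [List.nil_append]
      exact walkH_mono f₂ (f₁ + 1 + f₂) _ _ _ h₂ (by omega)
  | f₁ + 1, f₂, a, M, L, b :: rest, s₂, h₁, h₂ => by
      rw [show f₁ + 1 + f₂ = (f₁ + f₂) + 1 by omega, List.cons_append]
      simp only [walkH] at h₁ ⊢
      obtain ⟨hc, h'⟩ := bif_eq_some.1 h₁
      exact bif_eq_some.2 ⟨hc, walkH_append f₁ rest h' h₂⟩

/-! ### The tail as the concatenation of its eight pieces -/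

/-- `l.drop k = (l.drop k).take n ++ l.drop (k + n)`. [folklore] -/
theorem drop_eq_take_append_drop (l : List ℕ) (k n m : ℕ) (h : k + n = m) :
    l.drop k = (l.drop k).take n ++ l.drop m := by
  rw [← h, ← List.drop_drop, List.take_append_drop]

/-- Any list is the concatenation of its eight pieces of length `40305` and the rest. [folklore] -/
theorem pieces_eq (l : List ℕ) :
    l = (l.drop 0).take 40305 ++ ((l.drop 40305).take 40305 ++ ((l.drop 80610).take 40305 ++
      ((l.drop 120915).take 40305 ++ ((l.drop 161220).take 40305 ++ ((l.drop 201525).take 40305 ++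
      ((l.drop 241830).take 40305 ++ ((l.drop 282135).take 40305 ++ l.drop 322440))))))) := by
  rw [← drop_eq_take_append_drop l 282135 40305 322440 (by norm_num),
    ← drop_eq_take_append_drop l 241830 40305 282135 (by norm_num),
    ← drop_eq_take_append_drop l 201525 40305 241830 (by norm_num),
    ← drop_eq_take_append_drop l 161220 40305 201525 (by norm_num),
    ← drop_eq_take_append_drop l 120915 40305 161220 (by norm_num),
    ← drop_eq_take_append_drop l 80610 40305 120915 (by norm_num),
    ← drop_eq_take_append_drop l 40305 40305 80610 (by norm_num),
    ← drop_eq_take_append_drop l 0 40305 40305 (by norm_num)]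
  rfl

/-- **The walk over the whole tail of the table** succeeds from `a = 1` and ends at `4599989`
(the eight kernel pieces glued by `walkH_append`). [folklore] -/
theorem walk_tail : walkH 323201 1 table.tail = some 4599989 := by
  have h9 : walkH 1 4599989 (table.tail.drop 322440) = some 4599989 := by
    rw [tail_drop_nil]; rfl
  have h := walkH_append 40400 _ walk1 (walkH_append 40400 _ walk2 (walkH_append 40400 _ walk3
    (walkH_append 40400 _ walk4 (walkH_append 40400 _ walk5 (walkH_append 40400 _ walk6
    (walkH_append 40400 _ walk7 (walkH_append 40400 _ walk8 h9)))))))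
  rw [pieces_eq table.tail]
  exact h

/-! ### The head of the table and `TableOK` -/

/-- The table starts with `2` (lazy kernel evaluation of the first decoded entry). [folklore] -/
theorem head_table : table.head? = some 2 := by
  decide +kernel

/-- **Completeness of the table** in the form consumed by the chain checker: `ChainTable.table` is
strictly increasing, its entries lie in `[2, 4599989]`, it starts with `2`, and every prime
`p ≤ 4599989` is an entry. [folklore] -/
theorem tableOK : ChainCheck.TableOK table 4599989 := by
  obtain ⟨hsorted, hmem, -, -, hcomplete⟩ := walkH_sound _ _ _ _ walk_tail (by decide)
  have table_eq_cons_tail : table = 2 :: table.tail :=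
    List.eq_cons_of_mem_head? (Option.mem_def.mpr head_table)
  refine ⟨?_, ?_, head_table, ?_, ?_⟩
  · rw [table_eq_cons_tail, List.pairwise_cons]
    refine ⟨fun q hq => ?_, hsorted⟩
    obtain ⟨h1, -, ⟨k, hk⟩⟩ := hmem q hq
    omega
  · intro q hq
    rw [table_eq_cons_tail] at hq
    rcases List.mem_cons.1 hq with rfl | hq
    · exact le_rfl
    · have := (hmem q hq).1
      omega
  · intro q hq
    rw [table_eq_cons_tail] at hq
    rcases List.mem_cons.1 hq with rfl | hq
    · norm_num
    · exact (hmem q hq).2.1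
  · intro p hp hple
    rcases hp.eq_two_or_odd' with rfl | hodd
    · rw [table_eq_cons_tail]
      exact List.mem_cons_self
    · rw [table_eq_cons_tail]
      exact List.mem_cons_of_mem _ (hcomplete p hp hodd hp.one_lt hple)

end Literature.NumberTheory.LFunctions.ChainTable
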